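import Mathlib
import HarnessLib
import Summits.HubbardSuperconductivity.HubbardSuperconductivity.Theorems.KLProgrammeC4aSecondCumulantDegree
import Summits.HubbardSuperconductivity.HubbardSuperconductivity.Theorems.KLProgrammeC4aBareVertexStrings
import Summits.HubbardSuperconductivity.HubbardSuperconductivity.Theorems.KLProgrammeKLRegimeWickPairKernelDefs

/-!
# Route `KLProgramme` — crux C4a, S1 (c): the second cumulant's 4-leg kernel AT THE TADPOLE LEGS, with DIAGONAL lines —
# the three bubbles are explicit lattice loop sums over the bare vertex (pp at `K + Q`, ph-crossed at `K − Q`, ph-direct constant)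

Cell `gate-hubbard-kl`, lane hubbard-kl-c4a-1 (g6); helper for stub (C) `stub_twoLeg_curvature` of the engine-flow child `KLRegimeEngineV17F2`
(stmt-HubbardSuperconductivity-20437); memo HOME/hubbard-kl-c4a-1/C4A-PLAN.md §22.10 (c).  `…C4aSecondCumulantDegree` wrote
`kernel₄(e^{Δ_C}(WW) − (e^{Δ_C}W)²)`, `W = V_U + 𝒩_K`, for ANY covariance `C` as p1's one-line trees plus `½` the two-line bubbles over the DRESSED vertex
`W̃ = e^{Δ_C}W`.  Here:

* §1 degree: the dressed vertex has the BARE quartic kernel, `kernel W̃ 4 = kernel V_U 4` (`kernel_four_gaussConv_hubbardInteractionCT`); `Δ_C W` and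
  `e^{Δ_C}W − W − Δ_C W` have no quartic kernel;
* §2 line reduction: against two DIAGONAL lines (`contr C = diagContr ℓ`, true of every cutoff covariance `C^K_{>Λ}`, …WickPairKernelDefs) a four-fold label sum
  is a double frequency–momentum–spin sum read in the four orientations (`sum_diagContr_diagContr_mul`);
* §3 at the TADPOLE LEGS `Z = ((K,σ,+),(K,σ,−),(Q,τ,−),(Q,τ,+))` (`…C4aTadpoleRepresentation.tadpoleVertex_latticeMomentum`) the three bubbles of the explicit
  formula are, with `c_U = U(βL²)⁻³(4!)⁻¹` and the selection by `…C4aBareVertexStrings.kernel_hubbardInteraction_mmpp`: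
  **pp** `B(Z₀Z₃|Z₁Z₂) = [σ ≠ τ]·2c_U²·Σ_{p,p′}[p + p′ ≐ K + Q]ℓ(p)ℓ(p′)`, **ph-direct** `B(Z₂Z₃|Z₀Z₁) = −[σ = τ]·2c_U²·Σ_p ℓ(p)²` (a constant),
  **ph-crossed** `B(Z₀Z₂|Z₁Z₃) = −2c_U²·Σ_{p,p′}[p + Q ≐ p′ + K]ℓ(p)ℓ(p′)` (spin-blind), `≐` = equality of integer frequency labels and torus momenta.

Exact algebra; nothing about sizes; nothing asserts superconductivity.  References: Salmhofer 1999 §2.4 [cite: Salmhofer1999]; BGM 2006 §2.2 [cite: BenfattoGiulianiMastropietro2006].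
-/

noncomputable section

namespace Summit.HubbardSuperconductivity.HubbardSuperconductivity.Theorems.C4a

set_option linter.dupNamespace false -- summit = problem name (single-conjunct summit), D-0017

open Literature.MathematicalPhysics.QuantumLattice Literature.Probability.LatticeModels GrassmannAlgebra Finset Matrix
open Summit.HubbardSuperconductivity.HubbardSuperconductivity.Theorems.KLRegimeWick

variable {L M : ℕ} [NeZero L]

/-! ## §1 Degree: the dressed vertex has the bare quartic kernel -/

/-- `Δ_C W` has no quartic kernel (`W = V_U + 𝒩_K` has no `6`-kernels). -/
theorem kernel_four_grassmannLaplacian_hubbardInteractionCT (β U : ℝ) (K : TrigPolyC4v) (C : Matrix (HubbardFieldIdx L M) (HubbardFieldIdx L M) ℂ)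
    (X : Fin 4 → HubbardFieldIdx L M) : kernel ℂ (grassmannLaplacian ℂ C (hubbardInteractionCT L M β U K)) 4 X = 0 :=
  kernel_grassmannLaplacian_eq_zero_of ℂ C (fun Y => kernel_hubbardInteractionCT_eq_zero_of_four_lt β U K (by norm_num) Y) X

/-- `Δ_C(Δ_C W)` has no quartic kernel (`W` has no `8`-kernels). -/
theorem kernel_four_grassmannLaplacian_grassmannLaplacian_hubbardInteractionCT (β U : ℝ) (K : TrigPolyC4v)
    (C : Matrix (HubbardFieldIdx L M) (HubbardFieldIdx L M) ℂ) (X : Fin 4 → HubbardFieldIdx L M) :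
    kernel ℂ (grassmannLaplacian ℂ C (grassmannLaplacian ℂ C (hubbardInteractionCT L M β U K))) 4 X = 0 :=
  kernel_grassmannLaplacian_eq_zero_of ℂ C
    (fun Y => kernel_grassmannLaplacian_eq_zero_of ℂ C (fun Y' => kernel_hubbardInteractionCT_eq_zero_of_four_lt β U K (by norm_num) Y') Y) X

/-- `e^{Δ_C}W − W` has no quartic kernel. -/
theorem kernel_four_gaussConv_sub_self_hubbardInteractionCT (β U : ℝ) (K : TrigPolyC4v) (C : Matrix (HubbardFieldIdx L M) (HubbardFieldIdx L M) ℂ)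
    (X : Fin 4 → HubbardFieldIdx L M) : kernel ℂ (gaussConv ℂ C (hubbardInteractionCT L M β U K) - hubbardInteractionCT L M β U K) 4 X = 0 := by
  rw [kernel_gaussConv_sub_self_eq ℂ C (fun j hj Y => kernel_hubbardInteractionCT_eq_zero_of_four_lt β U K (by omega) Y) X,
    kernel_four_grassmannLaplacian_hubbardInteractionCT, kernel_four_grassmannLaplacian_grassmannLaplacian_hubbardInteractionCT, mul_zero, add_zero]

/-- `e^{Δ_C}W − W − Δ_C W` (the `≥ 2`-self-line part) has no quartic kernel. -/
theorem kernel_four_gaussConv_sub_sub_hubbardInteractionCT (β U : ℝ) (K : TrigPolyC4v) (C : Matrix (HubbardFieldIdx L M) (HubbardFieldIdx L M) ℂ)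
    (X : Fin 4 → HubbardFieldIdx L M) :
    kernel ℂ (gaussConv ℂ C (hubbardInteractionCT L M β U K) - hubbardInteractionCT L M β U K -
      grassmannLaplacian ℂ C (hubbardInteractionCT L M β U K)) 4 X = 0 := by
  rw [kernel_sub', kernel_four_gaussConv_sub_self_hubbardInteractionCT, kernel_four_grassmannLaplacian_hubbardInteractionCT, sub_zero]

/-- **The dressed vertex has the BARE quartic kernel**: `kernel (e^{Δ_C}(V_U + 𝒩_K)) 4 X = kernel V_U 4 X` for every covariance `C`. [cite: Salmhofer1999, §2.4] -/
theorem kernel_four_gaussConv_hubbardInteractionCT (β U : ℝ) (K : TrigPolyC4v) (C : Matrix (HubbardFieldIdx L M) (HubbardFieldIdx L M) ℂ)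
    (X : Fin 4 → HubbardFieldIdx L M) : kernel ℂ (gaussConv ℂ C (hubbardInteractionCT L M β U K)) 4 X = kernel ℂ (hubbardInteraction L M β U) 4 X := by
  have h := kernel_four_gaussConv_sub_self_hubbardInteractionCT β U K C X
  rw [kernel_sub', sub_eq_zero] at h
  rw [h, kernel_hubbardInteractionCT_four]

/-! ## §2 Line reduction against two diagonal lines -/

/-- **Two diagonal lines**: `Σ_{X,Y,X′,Y′} diagContr ℓ X Y · diagContr ℓ′ X′ Y′ · Φ X Y X′ Y′` is the double sum over the lines' frequency–momenta and spins
of `ℓ(p)ℓ′(p′)` times `Φ` read in the four orientations `(∓,±) ⊗ (∓,±)` with signs `+ − − +`. -/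
theorem sum_diagContr_diagContr_mul (ℓ ℓ' : FreqMomentum L M → ℂ)
    (Φ : HubbardFieldIdx L M → HubbardFieldIdx L M → HubbardFieldIdx L M → HubbardFieldIdx L M → ℂ) :
    ∑ X, ∑ Y, ∑ X', ∑ Y', diagContr L M ℓ X Y * diagContr L M ℓ' X' Y' * Φ X Y X' Y' =
      ∑ p : FreqMomentum L M, ∑ s : Fin 2, ∑ p' : FreqMomentum L M, ∑ s' : Fin 2, ℓ p * ℓ' p' *
        (Φ ((p, s), 1) ((p, s), 0) ((p', s'), 1) ((p', s'), 0) - Φ ((p, s), 1) ((p, s), 0) ((p', s'), 0) ((p', s'), 1) -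
          Φ ((p, s), 0) ((p, s), 1) ((p', s'), 1) ((p', s'), 0) + Φ ((p, s), 0) ((p, s), 1) ((p', s'), 0) ((p', s'), 1)) := by
  have h1 : ∀ X Y, ∑ X', ∑ Y', diagContr L M ℓ X Y * diagContr L M ℓ' X' Y' * Φ X Y X' Y' =
      diagContr L M ℓ X Y * ∑ p' : FreqMomentum L M, ∑ s' : Fin 2, ℓ' p' * (Φ X Y ((p', s'), 1) ((p', s'), 0) - Φ X Y ((p', s'), 0) ((p', s'), 1)) := by
    intro X Y
    rw [← sum_diagContr_mul ℓ' (Φ X Y), Finset.mul_sum]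
    refine Finset.sum_congr rfl fun X' _ => ?_
    rw [Finset.mul_sum]
    exact Finset.sum_congr rfl fun Y' _ => by ring
  simp_rw [h1]
  rw [sum_diagContr_mul]
  refine Finset.sum_congr rfl fun p _ => Finset.sum_congr rfl fun s _ => ?_
  rw [← Finset.sum_sub_distrib, Finset.mul_sum]
  refine Finset.sum_congr rfl fun p' _ => ?_
  rw [← Finset.sum_sub_distrib, Finset.mul_sum]
  exact Finset.sum_congr rfl fun s' _ => by ring

/-! ## §3 The three bubbles at the tadpole legs -/

section Bubbles

variable (β U : ℝ) {C : Matrix (HubbardFieldIdx L M) (HubbardFieldIdx L M) ℂ} {ℓ : FreqMomentum L M → ℂ}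

omit [NeZero L] in
/-- The integer frequency labels are injective. -/
theorem matsubaraInt_injective' : Function.Injective (matsubaraInt M) := fun i j h => by
  unfold matsubaraInt at h
  exact Fin.ext (by omega)

omit [NeZero L] in
/-- Conservation against a spectator label: `n_a + n_x = n_b + n_x ∧ a⃗ + x⃗ = b⃗ + x⃗ ↔ a = b`. -/
theorem conserving_cancel_right (a b x : FreqMomentum L M) :
    (matsubaraInt M a.1 + matsubaraInt M x.1 = matsubaraInt M b.1 + matsubaraInt M x.1 ∧ a.2 + x.2 = b.2 + x.2) ↔ a = b := by
  rw [add_left_inj, add_left_inj, matsubaraInt_injective'.eq_iff, Prod.ext_iff]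

/-- **The pp product at the tadpole legs**: `K4(p s −, p′ s′ −, K σ +, Q τ +)·K4(p s +, p′ s′ +, K σ −, Q τ −) = [σ ≠ τ][s ≠ s′][p + p′ ≐ K + Q]·c_U²`. -/
theorem kernel_mul_kernel_pp (Kx Q p p' : FreqMomentum L M) (σ τ s s' : Fin 2) :
    kernel ℂ (hubbardInteraction L M β U) 4 ![((p, s), 1), ((p', s'), 1), ((Kx, σ), 0), ((Q, τ), 0)] *
        kernel ℂ (hubbardInteraction L M β U) 4 ![((p, s), 0), ((p', s'), 0), ((Kx, σ), 1), ((Q, τ), 1)] =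
      if σ ≠ τ ∧ s ≠ s' ∧ (matsubaraInt M p.1 + matsubaraInt M p'.1 = matsubaraInt M Kx.1 + matsubaraInt M Q.1 ∧ p.2 + p'.2 = Kx.2 + Q.2) then
        ((((U / (β * (L : ℝ) ^ 2) ^ 3 : ℝ)) : ℂ) * (((4 : ℕ).factorial : ℚ)⁻¹ • (1 : ℂ))) ^ 2
      else 0 := by
  rw [kernel_hubbardInteraction_ppmm, kernel_hubbardInteraction_mmpp, kernel_hubbardInteraction_mmpp]
  have hsym : (matsubaraInt M Kx.1 + matsubaraInt M Q.1 = matsubaraInt M p.1 + matsubaraInt M p'.1 ∧ Kx.2 + Q.2 = p.2 + p'.2) ↔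
      (matsubaraInt M p.1 + matsubaraInt M p'.1 = matsubaraInt M Kx.1 + matsubaraInt M Q.1 ∧ p.2 + p'.2 = Kx.2 + Q.2) :=
    ⟨fun h => ⟨h.1.symm, h.2.symm⟩, fun h => ⟨h.1.symm, h.2.symm⟩⟩
  simp only [hsym]
  have two : ∀ x : Fin 2, x = 0 ∨ x = 1 := by decide
  by_cases hc : matsubaraInt M p.1 + matsubaraInt M p'.1 = matsubaraInt M Kx.1 + matsubaraInt M Q.1 ∧ p.2 + p'.2 = Kx.2 + Q.2
  · simp only [hc, and_true, if_true]
    rcases two σ with rfl | rfl <;> rcases two τ with rfl | rfl <;> rcases two s with rfl | rfl <;> rcases two s' with rfl | rfl <;>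
      simp <;> ring
  · simp [hc]

/-- **The pp bubble `B(Z₀Z₃|Z₁Z₂)` at the tadpole legs**, two diagonal lines `ℓ`:
`Σ contr·contr·K4(X,X′,Kσ+,Qτ+)·K4(Y,Y′,Kσ−,Qτ−) = [σ ≠ τ]·2c_U²·Σ_{p,p′}[p + p′ ≐ K + Q]ℓ(p)ℓ(p′)`. [cite: Salmhofer1999, §2.4] -/
theorem bubble_pp_tadpoleLegs (hC : contr ℂ C = diagContr L M ℓ) (Kx Q : FreqMomentum L M) (σ τ : Fin 2) :
    ∑ X, ∑ Y, ∑ X', ∑ Y', contr ℂ C X Y * contr ℂ C X' Y' *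
        (kernel ℂ (hubbardInteraction L M β U) 4 ![X, X', ((Kx, σ), 0), ((Q, τ), 0)] *
          kernel ℂ (hubbardInteraction L M β U) 4 ![Y, Y', ((Kx, σ), 1), ((Q, τ), 1)]) =
      if σ = τ then 0 else
        2 * ((((U / (β * (L : ℝ) ^ 2) ^ 3 : ℝ)) : ℂ) * (((4 : ℕ).factorial : ℚ)⁻¹ • (1 : ℂ))) ^ 2 *
          ∑ p : FreqMomentum L M, ∑ p' : FreqMomentum L M,
            if matsubaraInt M p.1 + matsubaraInt M p'.1 = matsubaraInt M Kx.1 + matsubaraInt M Q.1 ∧ p.2 + p'.2 = Kx.2 + Q.2 then ℓ p * ℓ p' else 0 := by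
  rw [hC, sum_diagContr_diagContr_mul]
  -- the three orientations with a wrong charge count vanish
  have h2 : ∀ (p p' : FreqMomentum L M) (s s' : Fin 2),
      kernel ℂ (hubbardInteraction L M β U) 4 ![((p, s), 1), ((p', s'), 0), ((Kx, σ), 0), ((Q, τ), 0)] = 0 := fun p p' s s' =>
    kernel_hubbardInteraction_eq_zero_of_three_charges β U _ (i := 1) (j := 2) (k := 3) (by decide) (by decide) (by decide) rfl rfl
  have h3 : ∀ (p p' : FreqMomentum L M) (s s' : Fin 2),
      kernel ℂ (hubbardInteraction L M β U) 4 ![((p, s), 0), ((p', s'), 1), ((Kx, σ), 0), ((Q, τ), 0)] = 0 := fun p p' s s' =>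
    kernel_hubbardInteraction_eq_zero_of_three_charges β U _ (i := 0) (j := 2) (k := 3) (by decide) (by decide) (by decide) rfl rfl
  have h4 : ∀ (p p' : FreqMomentum L M) (s s' : Fin 2),
      kernel ℂ (hubbardInteraction L M β U) 4 ![((p, s), 0), ((p', s'), 0), ((Kx, σ), 0), ((Q, τ), 0)] = 0 := fun p p' s s' =>
    kernel_hubbardInteraction_eq_zero_of_three_charges β U _ (i := 0) (j := 1) (k := 2) (by decide) (by decide) (by decide) rfl rfl
  simp_rw [h2, h3, h4, zero_mul, sub_zero, add_zero, kernel_mul_kernel_pp β U]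
  by_cases hστ : σ = τ
  · simp [hστ]
  rw [if_neg hστ, Finset.mul_sum]
  refine Finset.sum_congr rfl fun p _ => ?_
  rw [Finset.sum_comm, Finset.mul_sum]
  refine Finset.sum_congr rfl fun p' _ => ?_
  simp only [Fin.sum_univ_two, Fin.isValue, ne_eq, hστ, not_false_eq_true, true_and, zero_ne_one, one_ne_zero, not_true_eq_false,
    false_and, if_false]
  split_ifs <;> ring

/-- **The ph-direct bubble `B(Z₂Z₃|Z₀Z₁)` at the tadpole legs** (two diagonal lines `ℓ`):
`Σ contr·contr·K4(X,X′,Qτ−,Qτ+)·K4(Y,Y′,Kσ+,Kσ−) = −[σ = τ]·2c_U²·Σ_p ℓ(p)²` — transfer zero: a constant, blind to `K` and `Q`. [cite: Salmhofer1999, §2.4] -/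
theorem bubble_direct_tadpoleLegs (hC : contr ℂ C = diagContr L M ℓ) (Kx Q : FreqMomentum L M) (σ τ : Fin 2) :
    ∑ X, ∑ Y, ∑ X', ∑ Y', contr ℂ C X Y * contr ℂ C X' Y' *
        (kernel ℂ (hubbardInteraction L M β U) 4 ![X, X', ((Q, τ), 1), ((Q, τ), 0)] *
          kernel ℂ (hubbardInteraction L M β U) 4 ![Y, Y', ((Kx, σ), 0), ((Kx, σ), 1)]) =
      if σ = τ then
        -(2 * ((((U / (β * (L : ℝ) ^ 2) ^ 3 : ℝ)) : ℂ) * (((4 : ℕ).factorial : ℚ)⁻¹ • (1 : ℂ))) ^ 2 * ∑ p : FreqMomentum L M, ℓ p * ℓ p)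
      else 0 := by
  rw [hC, sum_diagContr_diagContr_mul]
  have h1 : ∀ (p p' : FreqMomentum L M) (s s' : Fin 2),
      kernel ℂ (hubbardInteraction L M β U) 4 ![((p, s), 1), ((p', s'), 1), ((Q, τ), 1), ((Q, τ), 0)] = 0 := fun p p' s s' =>
    kernel_hubbardInteraction_eq_zero_of_three_charges β U _ (i := 0) (j := 1) (k := 2) (by decide) (by decide) (by decide) rfl rfl
  have h4 : ∀ (p p' : FreqMomentum L M) (s s' : Fin 2),
      kernel ℂ (hubbardInteraction L M β U) 4 ![((p, s), 0), ((p', s'), 0), ((Q, τ), 1), ((Q, τ), 0)] = 0 := fun p p' s s' =>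
    kernel_hubbardInteraction_eq_zero_of_three_charges β U _ (i := 0) (j := 1) (k := 3) (by decide) (by decide) (by decide) rfl rfl
  -- the two surviving orientations, as products of master evaluations
  have h23 : ∀ (p p' : FreqMomentum L M) (s s' : Fin 2),
      kernel ℂ (hubbardInteraction L M β U) 4 ![((p, s), 1), ((p', s'), 0), ((Q, τ), 1), ((Q, τ), 0)] *
          kernel ℂ (hubbardInteraction L M β U) 4 ![((p, s), 0), ((p', s'), 1), ((Kx, σ), 0), ((Kx, σ), 1)] =
        if σ = τ ∧ s ≠ σ ∧ s' ≠ σ ∧ p = p' then ((((U / (β * (L : ℝ) ^ 2) ^ 3 : ℝ)) : ℂ) * (((4 : ℕ).factorial : ℚ)⁻¹ • (1 : ℂ))) ^ 2 else 0 := by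
    intro p p' s s'
    rw [kernel_hubbardInteraction_mpmp, kernel_hubbardInteraction_pmpm, kernel_hubbardInteraction_mmpp, kernel_hubbardInteraction_mmpp]
    simp only [conserving_cancel_right]
    have two : ∀ x : Fin 2, x = 0 ∨ x = 1 := by decide
    by_cases hpp : p = p'
    · subst hpp
      simp only [and_true, if_true]
      rcases two σ with rfl | rfl <;> rcases two τ with rfl | rfl <;> rcases two s with rfl | rfl <;> rcases two s' with rfl | rfl <;>
        simp <;> ring
    · have hpp' : ¬p' = p := fun h => hpp h.symm
      simp [hpp, hpp']
  have h32 : ∀ (p p' : FreqMomentum L M) (s s' : Fin 2),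
      kernel ℂ (hubbardInteraction L M β U) 4 ![((p, s), 0), ((p', s'), 1), ((Q, τ), 1), ((Q, τ), 0)] *
          kernel ℂ (hubbardInteraction L M β U) 4 ![((p, s), 1), ((p', s'), 0), ((Kx, σ), 0), ((Kx, σ), 1)] =
        if σ = τ ∧ s ≠ σ ∧ s' ≠ σ ∧ p = p' then ((((U / (β * (L : ℝ) ^ 2) ^ 3 : ℝ)) : ℂ) * (((4 : ℕ).factorial : ℚ)⁻¹ • (1 : ℂ))) ^ 2 else 0 := by
    intro p p' s s'
    rw [kernel_hubbardInteraction_pmmp, kernel_hubbardInteraction_mppm, kernel_hubbardInteraction_mmpp, kernel_hubbardInteraction_mmpp]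
    simp only [conserving_cancel_right]
    have two : ∀ x : Fin 2, x = 0 ∨ x = 1 := by decide
    by_cases hpp : p = p'
    · subst hpp
      simp only [and_true, if_true]
      rcases two σ with rfl | rfl <;> rcases two τ with rfl | rfl <;> rcases two s with rfl | rfl <;> rcases two s' with rfl | rfl <;>
        simp <;> ring
    · have hpp' : ¬p' = p := fun h => hpp h.symm
      simp [hpp, hpp']
  simp_rw [h1, h4, zero_mul, zero_sub, add_zero, h23, h32]
  by_cases hστ : σ = τ
  · subst hστ
    rw [if_pos rfl, Finset.mul_sum, ← Finset.sum_neg_distrib]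
    refine Finset.sum_congr rfl fun p _ => ?_
    rw [Finset.sum_comm]
    have two : ∀ x : Fin 2, x = 0 ∨ x = 1 := by decide
    rw [Finset.sum_eq_single p (fun p' _ hp' => by simp [Ne.symm hp']) (fun h => absurd (Finset.mem_univ p) h)]
    rcases two σ with rfl | rfl <;> simp [Fin.sum_univ_two] <;> ring
  · simp [hστ]

/-- **The ph-crossed bubble `B(Z₀Z₂|Z₁Z₃)` at the tadpole legs** (two diagonal lines `ℓ`):
`Σ contr·contr·K4(X,X′,Kσ+,Qτ−)·K4(Y,Y′,Kσ−,Qτ+) = −2c_U²·Σ_{p,p′}[p + Q ≐ p′ + K]ℓ(p)ℓ(p′)` — transfer `K − Q`, the SAME for all four spin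
configurations. [cite: Salmhofer1999, §2.4] -/
theorem bubble_crossed_tadpoleLegs (hC : contr ℂ C = diagContr L M ℓ) (Kx Q : FreqMomentum L M) (σ τ : Fin 2) :
    ∑ X, ∑ Y, ∑ X', ∑ Y', contr ℂ C X Y * contr ℂ C X' Y' *
        (kernel ℂ (hubbardInteraction L M β U) 4 ![X, X', ((Kx, σ), 0), ((Q, τ), 1)] *
          kernel ℂ (hubbardInteraction L M β U) 4 ![Y, Y', ((Kx, σ), 1), ((Q, τ), 0)]) =
      -(2 * ((((U / (β * (L : ℝ) ^ 2) ^ 3 : ℝ)) : ℂ) * (((4 : ℕ).factorial : ℚ)⁻¹ • (1 : ℂ))) ^ 2 *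
        ∑ p : FreqMomentum L M, ∑ p' : FreqMomentum L M,
          if matsubaraInt M p.1 + matsubaraInt M Q.1 = matsubaraInt M p'.1 + matsubaraInt M Kx.1 ∧ p.2 + Q.2 = p'.2 + Kx.2 then ℓ p * ℓ p' else 0) := by
  rw [hC, sum_diagContr_diagContr_mul]
  have h1 : ∀ (p p' : FreqMomentum L M) (s s' : Fin 2),
      kernel ℂ (hubbardInteraction L M β U) 4 ![((p, s), 1), ((p', s'), 1), ((Kx, σ), 0), ((Q, τ), 1)] = 0 := fun p p' s s' =>
    kernel_hubbardInteraction_eq_zero_of_three_charges β U _ (i := 0) (j := 1) (k := 3) (by decide) (by decide) (by decide) rfl rfl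
  have h4 : ∀ (p p' : FreqMomentum L M) (s s' : Fin 2),
      kernel ℂ (hubbardInteraction L M β U) 4 ![((p, s), 0), ((p', s'), 0), ((Kx, σ), 0), ((Q, τ), 1)] = 0 := fun p p' s s' =>
    kernel_hubbardInteraction_eq_zero_of_three_charges β U _ (i := 0) (j := 1) (k := 2) (by decide) (by decide) (by decide) rfl rfl
  have h23 : ∀ (p p' : FreqMomentum L M) (s s' : Fin 2),
      kernel ℂ (hubbardInteraction L M β U) 4 ![((p, s), 1), ((p', s'), 0), ((Kx, σ), 0), ((Q, τ), 1)] *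
          kernel ℂ (hubbardInteraction L M β U) 4 ![((p, s), 0), ((p', s'), 1), ((Kx, σ), 1), ((Q, τ), 0)] =
        if s ≠ τ ∧ s' ≠ σ ∧ (matsubaraInt M p.1 + matsubaraInt M Q.1 = matsubaraInt M p'.1 + matsubaraInt M Kx.1 ∧ p.2 + Q.2 = p'.2 + Kx.2) then
          ((((U / (β * (L : ℝ) ^ 2) ^ 3 : ℝ)) : ℂ) * (((4 : ℕ).factorial : ℚ)⁻¹ • (1 : ℂ))) ^ 2 else 0 := by
    intro p p' s s'
    rw [kernel_hubbardInteraction_mppm, kernel_hubbardInteraction_pmmp, kernel_hubbardInteraction_mmpp, kernel_hubbardInteraction_mmpp]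
    have hsym : (matsubaraInt M p'.1 + matsubaraInt M Kx.1 = matsubaraInt M p.1 + matsubaraInt M Q.1 ∧ p'.2 + Kx.2 = p.2 + Q.2) ↔
        (matsubaraInt M p.1 + matsubaraInt M Q.1 = matsubaraInt M p'.1 + matsubaraInt M Kx.1 ∧ p.2 + Q.2 = p'.2 + Kx.2) :=
      ⟨fun h => ⟨h.1.symm, h.2.symm⟩, fun h => ⟨h.1.symm, h.2.symm⟩⟩
    simp only [hsym]
    have two : ∀ x : Fin 2, x = 0 ∨ x = 1 := by decide
    by_cases hc : matsubaraInt M p.1 + matsubaraInt M Q.1 = matsubaraInt M p'.1 + matsubaraInt M Kx.1 ∧ p.2 + Q.2 = p'.2 + Kx.2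
    · simp only [hc, and_true, if_true]
      rcases two σ with rfl | rfl <;> rcases two τ with rfl | rfl <;> rcases two s with rfl | rfl <;> rcases two s' with rfl | rfl <;>
        simp <;> ring
    · simp [hc]
  have h32 : ∀ (p p' : FreqMomentum L M) (s s' : Fin 2),
      kernel ℂ (hubbardInteraction L M β U) 4 ![((p, s), 0), ((p', s'), 1), ((Kx, σ), 0), ((Q, τ), 1)] *
          kernel ℂ (hubbardInteraction L M β U) 4 ![((p, s), 1), ((p', s'), 0), ((Kx, σ), 1), ((Q, τ), 0)] =
        if s ≠ σ ∧ s' ≠ τ ∧ (matsubaraInt M p'.1 + matsubaraInt M Q.1 = matsubaraInt M p.1 + matsubaraInt M Kx.1 ∧ p'.2 + Q.2 = p.2 + Kx.2) then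
          ((((U / (β * (L : ℝ) ^ 2) ^ 3 : ℝ)) : ℂ) * (((4 : ℕ).factorial : ℚ)⁻¹ • (1 : ℂ))) ^ 2 else 0 := by
    intro p p' s s'
    rw [kernel_hubbardInteraction_pmpm, kernel_hubbardInteraction_mpmp, kernel_hubbardInteraction_mmpp, kernel_hubbardInteraction_mmpp]
    have hsym : (matsubaraInt M p.1 + matsubaraInt M Kx.1 = matsubaraInt M p'.1 + matsubaraInt M Q.1 ∧ p.2 + Kx.2 = p'.2 + Q.2) ↔
        (matsubaraInt M p'.1 + matsubaraInt M Q.1 = matsubaraInt M p.1 + matsubaraInt M Kx.1 ∧ p'.2 + Q.2 = p.2 + Kx.2) :=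
      ⟨fun h => ⟨h.1.symm, h.2.symm⟩, fun h => ⟨h.1.symm, h.2.symm⟩⟩
    simp only [hsym]
    have two : ∀ x : Fin 2, x = 0 ∨ x = 1 := by decide
    by_cases hc : matsubaraInt M p'.1 + matsubaraInt M Q.1 = matsubaraInt M p.1 + matsubaraInt M Kx.1 ∧ p'.2 + Q.2 = p.2 + Kx.2
    · simp only [hc, and_true, if_true]
      rcases two σ with rfl | rfl <;> rcases two τ with rfl | rfl <;> rcases two s with rfl | rfl <;> rcases two s' with rfl | rfl <;>
        simp <;> ring
    · simp [hc]
  simp_rw [h1, h4, zero_mul, zero_sub, add_zero, h23, h32]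
  set Xc : ℂ := ((((U / (β * (L : ℝ) ^ 2) ^ 3 : ℝ)) : ℂ) * (((4 : ℕ).factorial : ℚ)⁻¹ • (1 : ℂ))) ^ 2 with hXc
  -- per `(p, p′)` the spin sums select one configuration in each of the two indicator families
  have hin : ∀ p p' : FreqMomentum L M, ∑ s : Fin 2, ∑ s' : Fin 2, ℓ p * ℓ p' *
      (-(if s ≠ τ ∧ s' ≠ σ ∧ (matsubaraInt M p.1 + matsubaraInt M Q.1 = matsubaraInt M p'.1 + matsubaraInt M Kx.1 ∧ p.2 + Q.2 = p'.2 + Kx.2) then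
            Xc else 0) -
        (if s ≠ σ ∧ s' ≠ τ ∧ (matsubaraInt M p'.1 + matsubaraInt M Q.1 = matsubaraInt M p.1 + matsubaraInt M Kx.1 ∧ p'.2 + Q.2 = p.2 + Kx.2) then
            Xc else 0)) =
      -(Xc * ((if matsubaraInt M p.1 + matsubaraInt M Q.1 = matsubaraInt M p'.1 + matsubaraInt M Kx.1 ∧ p.2 + Q.2 = p'.2 + Kx.2 then ℓ p * ℓ p' else 0) +
        (if matsubaraInt M p'.1 + matsubaraInt M Q.1 = matsubaraInt M p.1 + matsubaraInt M Kx.1 ∧ p'.2 + Q.2 = p.2 + Kx.2 then ℓ p' * ℓ p else 0))) := by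
    intro p p'
    have two : ∀ x : Fin 2, x = 0 ∨ x = 1 := by decide
    by_cases hc : matsubaraInt M p.1 + matsubaraInt M Q.1 = matsubaraInt M p'.1 + matsubaraInt M Kx.1 ∧ p.2 + Q.2 = p'.2 + Kx.2 <;>
      by_cases hc' : matsubaraInt M p'.1 + matsubaraInt M Q.1 = matsubaraInt M p.1 + matsubaraInt M Kx.1 ∧ p'.2 + Q.2 = p.2 + Kx.2 <;>
      rcases two σ with rfl | rfl <;> rcases two τ with rfl | rfl <;> simp [Fin.sum_univ_two, hc, hc'] <;> ring
  -- the second family is the first with `p ↔ p′`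
  have hsymm : ∑ p : FreqMomentum L M, ∑ p' : FreqMomentum L M,
      (if matsubaraInt M p'.1 + matsubaraInt M Q.1 = matsubaraInt M p.1 + matsubaraInt M Kx.1 ∧ p'.2 + Q.2 = p.2 + Kx.2 then ℓ p' * ℓ p else 0) =
      ∑ p : FreqMomentum L M, ∑ p' : FreqMomentum L M,
        (if matsubaraInt M p.1 + matsubaraInt M Q.1 = matsubaraInt M p'.1 + matsubaraInt M Kx.1 ∧ p.2 + Q.2 = p'.2 + Kx.2 then ℓ p * ℓ p' else 0) :=
    Finset.sum_comm
  calc _ = ∑ p : FreqMomentum L M, ∑ p' : FreqMomentum L M, ∑ s : Fin 2, ∑ s' : Fin 2, ℓ p * ℓ p' *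
        (-(if s ≠ τ ∧ s' ≠ σ ∧ (matsubaraInt M p.1 + matsubaraInt M Q.1 = matsubaraInt M p'.1 + matsubaraInt M Kx.1 ∧ p.2 + Q.2 = p'.2 + Kx.2) then
              Xc else 0) -
          (if s ≠ σ ∧ s' ≠ τ ∧ (matsubaraInt M p'.1 + matsubaraInt M Q.1 = matsubaraInt M p.1 + matsubaraInt M Kx.1 ∧ p'.2 + Q.2 = p.2 + Kx.2) then
              Xc else 0)) := Finset.sum_congr rfl fun p _ => Finset.sum_comm
    _ = ∑ p : FreqMomentum L M, ∑ p' : FreqMomentum L M,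
        -(Xc * ((if matsubaraInt M p.1 + matsubaraInt M Q.1 = matsubaraInt M p'.1 + matsubaraInt M Kx.1 ∧ p.2 + Q.2 = p'.2 + Kx.2 then ℓ p * ℓ p' else 0) +
          (if matsubaraInt M p'.1 + matsubaraInt M Q.1 = matsubaraInt M p.1 + matsubaraInt M Kx.1 ∧ p'.2 + Q.2 = p.2 + Kx.2 then ℓ p' * ℓ p else 0))) :=
        Finset.sum_congr rfl fun p _ => Finset.sum_congr rfl fun p' _ => hin p p'
    _ = -(Xc * (∑ p : FreqMomentum L M, ∑ p' : FreqMomentum L M,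
          (if matsubaraInt M p.1 + matsubaraInt M Q.1 = matsubaraInt M p'.1 + matsubaraInt M Kx.1 ∧ p.2 + Q.2 = p'.2 + Kx.2 then ℓ p * ℓ p' else 0) +
        ∑ p : FreqMomentum L M, ∑ p' : FreqMomentum L M,
          (if matsubaraInt M p'.1 + matsubaraInt M Q.1 = matsubaraInt M p.1 + matsubaraInt M Kx.1 ∧ p'.2 + Q.2 = p.2 + Kx.2 then ℓ p' * ℓ p else 0))) := by
        rw [← Finset.sum_add_distrib, Finset.mul_sum, ← Finset.sum_neg_distrib]
        refine Finset.sum_congr rfl fun p _ => ?_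
        rw [← Finset.sum_add_distrib, Finset.mul_sum, ← Finset.sum_neg_distrib]
    _ = _ := by rw [hsymm]; ring

end Bubbles

end Summit.HubbardSuperconductivity.HubbardSuperconductivity.Theorems.C4a

end
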